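import Summits.BirchSwinnertonDyer.BirchSwinnertonDyer.Theorems.Rank2Observatory2DescClFieldCert
import Summits.BirchSwinnertonDyer.BirchSwinnertonDyer.Theorems.Rank2Observatory2DescClEtaCert
import Summits.BirchSwinnertonDyer.BirchSwinnertonDyer.Theorems.Rank2Observatory2DescClClassGenGcd
import HarnessLib

/-!
# BirchSwinnertonDyer — rank ≥ 2 observatory: KERNEL-2DESC-CL v2.3 — the TWO-VIEW per-field record

HONEST FRAMING: per-curve certified theorems and census instruments; no claim on BSD in rank ≥ 2.

File 3 of v2.0 (`…2DescClFieldCert`) certifies a cubic field `K = ℚ(α)` only when `𝓞 K = ℤ[α]`: its `indexCheck` refuses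
the primes dividing `[𝓞 K : ℤ[α]]`.  For a NON-monogenic presentation (`[𝓞 K : ℤ[α]] = d > 1`, census cut 2c-A) this file
adds a SECOND MONOGENIC VIEW `η = u(α)/d` with monic minimal polynomial `X³ + a′X² + b′X + c′` (certified by `etaCheck`,
`…2DescClEtaCert`) such that the index primes of `α` do not divide `[𝓞 K : ℤ[η]]`; the primes above them are named through
`η` by ordinary file-2 rows over `(a′, b′, c′)` (`primesE`) with file-2 class certificates in the `η`-view.  Everything else
(the auxiliary prime `q = W₁W₂`, the `α`-rows, the residue characters) is the v2.0 record `base : ClFieldCert` verbatim.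
`ClFieldCert.checkReg` = the REGISTRY CORE of a v2.0 record (v2.1 `checkCore` minus the sweep) with the field-level consequences
re-derived from it alone (`irreducible_of_reg`, …, `exists_psi_of_reg`; `checkReg_of_core`); `ClFieldCertE` = `base` +
`(u, d, a′, b′, c′, pIrrE, primesE)`, `checkCoreE` = `base.checkReg ∧ etaCheck ∧ noRootMod pIrrE h ∧ checkRegistryE ∧ checkSweepE`
(the TWO-VIEW SWEEP covers every prime `p < bM` by `q`, an `α`-row or an `η`-row, with a class certificate of every code in its
own view); `ClFieldCertE.closure_q_eq_top_of_coreE` — **the classes of the primes above `q` generate `Cl(K)`**.  Signature-free;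
new file only; sorry-free; axioms `propext`, `Classical.choice`, `Quot.sound`.  [cite: Cohen1993, §4.8.2, §6.2 (orders and the index), §6.5]
[cite: Marcus2018, Ch. 3, Thm. 27; Ch. 5, Thm. 35 and Cor. 2] [cite: Cassels1991LecturesEllipticCurves, §15]
-/

set_option linter.dupNamespace false

noncomputable section

open scoped Classical NumberField nonZeroDivisors

open Literature.NumberTheory.NumberFields Polynomial Module NumberField IsDedekindDomain Ideal

namespace Summit.BirchSwinnertonDyer.BirchSwinnertonDyer.Rank2Observatory.TwoDescCl

open TwoDescCubic

/-! ## The registry core of a v2.0 record -/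

namespace ClFieldCert

/-- **Registry core**: irreducibility modulo `pIrr`, the registry rows (incl. the row of `q`), the residue
characters — no archimedean clause, no sweep. Computable. [cite: Cohen1993, §6.5] -/
def checkReg (fc : ClFieldCert) : Bool :=
  noRootMod fc.pIrr fc.a fc.b fc.c && fc.checkRegistry && fc.checkChars

/-- The full v2.0 checker implies the registry core. -/
theorem checkReg_of_check (fc : ClFieldCert) (hF : fc.check = true) : fc.checkReg = true := by
  simp only [check, checkField, checkReg, Bool.and_eq_true] at hF ⊢
  exact ⟨⟨hF.1.1.1.1.1, hF.1.2⟩, hF.2⟩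

end ClFieldCert

variable {K : Type*} [Field K] [NumberField K] {θ : K} (fc : ClFieldCert)

namespace ClFieldCert

/-- `g` is irreducible. [folklore] -/
theorem irreducible_of_reg (hR : fc.checkReg = true) : Irreducible (MonicCubic.polyQ fc.a fc.b fc.c) := by
  simp only [checkReg, Bool.and_eq_true] at hR
  exact irreducible_of_noRootMod hR.1.1

/-- Every registry row is checked, and its prime is not `q`. -/
theorem row_check_of_mem_reg (hR : fc.checkReg = true) {e : PrimeEntry} (he : e ∈ fc.primes) :
    e.check fc.a fc.b fc.c = true ∧ e.p ≠ fc.q := by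
  simp only [checkReg, checkRegistry, Bool.and_eq_true, List.all_eq_true] at hR
  have h := hR.1.2.2 e he
  exact ⟨h.1, by simpa using h.2⟩

/-- The row of `q` is checked. -/
theorem qEntry_check_reg (hR : fc.checkReg = true) : fc.qEntry.check fc.a fc.b fc.c = true := by
  simp only [checkReg, checkRegistry, Bool.and_eq_true] at hR
  exact hR.1.2.1

/-- `W₁` is a prime above `q` of norm `q`. [cite: Cohen1993, §4.8.2] -/
theorem w₁_of_reg (hθ : aeval θ (MonicCubic.poly fc.a fc.b fc.c) = 0) (h3 : finrank ℚ K = 3)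
    (hR : fc.checkReg = true) (hpr : fc.primeList.Forall Nat.Prime) :
    idealOf hθ fc.w₁ ∈ primesOver (span {(fc.q : ℤ)}) (𝓞 K) ∧ absNorm (idealOf hθ fc.w₁) = fc.q := by
  have h := (primeEntry_sound (fc.irreducible_of_reg hR) hθ h3 fc.qEntry (fc.q_prime hpr)
    (fc.qEntry_check_reg hR)).1 fc.w₁ (by rw [qEntry_codes]; simp)
  have hdeg : codeDeg fc.w₁ = 1 := by simp [codeDeg, w₁]
  rw [hdeg, pow_one] at h
  exact h

/-- `W₂` is a prime above `q` of norm `q²`. [cite: Cohen1993, §4.8.2] -/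
theorem w₂_of_reg (hθ : aeval θ (MonicCubic.poly fc.a fc.b fc.c) = 0) (h3 : finrank ℚ K = 3)
    (hR : fc.checkReg = true) (hpr : fc.primeList.Forall Nat.Prime) :
    idealOf hθ fc.w₂ ∈ primesOver (span {(fc.q : ℤ)}) (𝓞 K) ∧ absNorm (idealOf hθ fc.w₂) = fc.q ^ 2 := by
  have h := (primeEntry_sound (fc.irreducible_of_reg hR) hθ h3 fc.qEntry (fc.q_prime hpr)
    (fc.qEntry_check_reg hR)).1 fc.w₂ (by rw [qEntry_codes]; simp)
  have hdeg : codeDeg fc.w₂ = 2 := by simp [codeDeg, w₂]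
  rw [hdeg] at h
  exact h

/-- Every prime containing `q` is `W₁` or `W₂`. [cite: Cohen1993, §4.8.2, Thm. 4.8.13] -/
theorem qcover_of_reg (hθ : aeval θ (MonicCubic.poly fc.a fc.b fc.c) = 0) (h3 : finrank ℚ K = 3)
    (hR : fc.checkReg = true) (hpr : fc.primeList.Forall Nat.Prime) (P : Ideal (𝓞 K)) (hP : P.IsPrime)
    (hq : (fc.q : 𝓞 K) ∈ P) : P = idealOf hθ fc.w₁ ∨ P = idealOf hθ fc.w₂ := by
  obtain ⟨C, hC, rfl⟩ := (primeEntry_sound (fc.irreducible_of_reg hR) hθ h3 fc.qEntry (fc.q_prime hpr)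
    (fc.qEntry_check_reg hR)).2 P hP hq
  rw [qEntry_codes] at hC
  simp only [List.mem_cons, List.not_mem_nil, or_false] at hC
  rcases hC with rfl | rfl
  · exact Or.inl rfl
  · exact Or.inr rfl

/-- `W₁ ≠ W₂` (different norms). [folklore] -/
theorem w₁_ne_w₂_reg (hθ : aeval θ (MonicCubic.poly fc.a fc.b fc.c) = 0) (h3 : finrank ℚ K = 3)
    (hR : fc.checkReg = true) (hpr : fc.primeList.Forall Nat.Prime) :
    idealOf hθ fc.w₁ ≠ idealOf hθ fc.w₂ := by
  intro h
  have h₁ := (fc.w₁_of_reg hθ h3 hR hpr).2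
  have h₂ := (fc.w₂_of_reg hθ h3 hR hpr).2
  rw [h, h₂] at h₁
  have hq := (fc.q_prime hpr).one_lt
  have : fc.q ^ 2 = fc.q ^ 1 := by rw [pow_one]; exact h₁
  exact absurd (Nat.pow_right_injective hq this) (by norm_num)

/-- **The residue map `ψ_{ℓ,t} : 𝓞 K → ℤ/ℓ`, `α ↦ t`**, for every character row, with `ℓ` an odd prime.
[cite: Marcus2018, Ch. 3, Thm. 27] -/
theorem exists_psi_of_reg (hθ : aeval θ (MonicCubic.poly fc.a fc.b fc.c) = 0) (h3 : finrank ℚ K = 3)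
    (hR : fc.checkReg = true) (hpr : fc.primeList.Forall Nat.Prime) {ch : ℕ × ℤ × ℤ} (hch : ch ∈ fc.chars) :
    2 < ch.1 ∧ ∃ ψ : 𝓞 K →+* ZMod ch.1, ψ (MonicCubic.thetaInt hθ) = ((ch.2.1 : ℤ) : ZMod ch.1) := by
  have hirr := fc.irreducible_of_reg hR
  simp only [checkReg, checkChars, Bool.and_eq_true, decide_eq_true_eq, List.all_eq_true] at hR
  obtain ⟨⟨h2, hroot⟩, hinv⟩ := hR.2 ch hch
  obtain ⟨ℓ, t, dinv⟩ := ch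
  simp only at h2 hroot hinv ⊢
  have hℓ : ℓ.Prime := fc.char_prime hpr hch
  haveI : NeZero ℓ := ⟨hℓ.ne_zero⟩
  refine ⟨h2, MonicCubic.exists_ringHom_of_root_of_mul_mem hirr hθ h3 (natAbs_disc_mul_mem_adjoin hirr hθ h3)
    ((t : ℤ) : ZMod ℓ) ?_ ((dinv : ℤ) : ZMod ℓ) ?_⟩
  · have h0 := (ZMod.intCast_zmod_eq_zero_iff_dvd _ ℓ).mpr (Int.dvd_of_emod_eq_zero hroot)
    push_cast at h0
    exact h0
  · have h1 : ((((MonicCubic.disc fc.a fc.b fc.c).natAbs : ℤ) * dinv : ℤ) : ZMod ℓ) = ((1 : ℤ) : ZMod ℓ) := by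
      rw [ZMod.intCast_eq_intCast_iff', hinv, Int.emod_eq_of_lt (by norm_num) (by have := hℓ.one_lt; omega)]
    simp only [Int.cast_mul, Int.cast_natCast, Int.cast_one] at h1
    exact h1

end ClFieldCert

/-! ## The two-view record -/

/-- **Relation certificate through a multiple.** In the view `θv` (root of `X³ + AX² + BX + C₀`): if
`m·β = Z(θv)` with `m` prime to `p`, `Z(θv) ∈ (p, G(θv))` by coefficients and `|N(Z)| = m³ · p^deg · q^j`, then
`β ∈ (p, G(θv))` with `|N(β)| = p^deg · q^j`, so the class of `(p, G(θv))` lies in `H_q`.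
[cite: Marcus2018, Ch. 5, Thm. 35] [cite: Cohen1993, §6.5 (relations)] -/
theorem classIn_of_rel2 {A B C₀ : ℤ} {θv : K} (hirr : Irreducible (MonicCubic.polyQ A B C₀))
    (hθv : aeval θv (MonicCubic.poly A B C₀) = 0) (h3 : finrank ℚ K = 3) {e : PrimeEntry} (hp : e.p.Prime)
    (h : e.check A B C₀ = true) {C : PCode} (hC : C ∈ e.codes) {q : ℕ} (hq : q.Prime) {m : ℕ}
    (hm : Nat.Coprime m C.1) {Z : ℤ × ℤ × ℤ} (hmem : memCode C Z = true) {β : 𝓞 K}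
    (hβ : (m : 𝓞 K) * β = lin hθv Z.1 Z.2.1 Z.2.2) {j : ℕ}
    (hN : (normFormZ A B C₀ Z.1 Z.2.1 Z.2.2).natAbs = m ^ 3 * (C.1 ^ codeDeg C * q ^ j)) :
    ClassIn (Subgroup.closure {cc : ClassGroup (𝓞 K) | ∃ (J : Ideal (𝓞 K)) (hJ : J ∈ (Ideal (𝓞 K))⁰),
      ((q : ℕ) : 𝓞 K) ∈ J ∧ ClassGroup.mk0 ⟨J, hJ⟩ = cc}) (idealOf hθv C) := by
  have hP := isPrime_and_ne_bot_of_check hirr hθv h3 hp h hC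
  have habs := absNorm_of_check hirr hθv h3 hp h hC
  have hfst := code_fst_of_mem hC
  have hlin : lin hθv Z.1 Z.2.1 Z.2.2 ∈ idealOf hθv C := lin_mem_idealOf_of_memCode hθv C _ hmem
  have hpmem : ((C.1 : ℕ) : 𝓞 K) ∈ idealOf hθv C := by
    unfold idealOf; exact Ideal.subset_span (Set.mem_insert _ _)
  let w : HeightOneSpectrum (𝓞 K) := ⟨idealOf hθv C, hP.1, hP.2⟩
  have hmw : (m : 𝓞 K) ∉ w.asIdeal := natCast_not_mem_of_coprime w hpmem hm
  have hβmem : β ∈ idealOf hθv C := (mem_iff_of_natCast_mul_eq w hmw hβ).mpr hlin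
  have hm0 : 0 < m := by
    rcases Nat.eq_zero_or_pos m with rfl | h0
    · rw [Nat.coprime_zero_left, hfst] at hm; exact absurd hm hp.one_lt.ne'
    · exact h0
  have h1 : (Algebra.norm ℤ ((m : 𝓞 K) * β)).natAbs = m ^ 3 * (C.1 ^ codeDeg C * q ^ j) := by
    rw [hβ, natAbs_norm_lin_coords hirr hθv h3 Z]; exact hN
  have hnm : Algebra.norm ℤ (m : 𝓞 K) = (m : ℤ) ^ 3 := by
    rw [show (m : 𝓞 K) = algebraMap ℤ (𝓞 K) (m : ℤ) by simp, Algebra.norm_algebraMap,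
      NumberField.RingOfIntegers.rank, h3]
  rw [map_mul, hnm, Int.natAbs_mul, Int.natAbs_pow, Int.natAbs_natCast] at h1
  have h2 : (Algebra.norm ℤ β).natAbs = absNorm (idealOf hθv C) * q ^ j := by
    rw [habs, ← hfst]
    exact Nat.eq_of_mul_eq_mul_left (pow_pos hm0 3) h1
  exact classIn_tsupp_of_rel hq hP.2 hβmem j h2

/-- **Two-view class-certificate data**: multipliers `m₁, m₂` with a Bezout pair `s·m₁ + t·m₂ = 1` and the
certificates `((tag, code), X, Y, j)` — the element `x = s·X(α) + t·Y(η) ∈ 𝓞 K` (`m₁x = X(α)`, `m₂x = Y(η)`)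
lies in the code's prime and `|N(x)| = p^deg · q^j`, read in the code's own view (`tag = true`: `α`, on `X`;
`false`: `η`, on `Y`).  Needed when no such `x` lies in the view's ORDER (`ℤ[α]` resp. `ℤ[η]`). Pure data. -/
structure ClsCert2 where
  /-- the `α`-multiplier -/
  m₁ : ℕ
  /-- the `η`-multiplier -/
  m₂ : ℕ
  /-- Bezout: `s m₁ + t m₂ = 1` -/
  s : ℤ
  /-- Bezout: `s m₁ + t m₂ = 1` -/
  t : ℤ
  /-- the certificates `((tag, code), X, Y, j)` -/
  certs : List ((Bool × PCode) × (ℤ × ℤ × ℤ) × (ℤ × ℤ × ℤ) × ℕ)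

/-- **Two-view per-field certificate**: a v2.0 record `base` for the `α`-view (its `primes` are rows of
non-index primes only; its sweep clause is NOT used) plus the second generator `η = u(α)/d`, its minimal
polynomial `h = X³ + a′X² + b′X + c′`, an irreducibility modulus for `h`, and the `η`-rows `primesE` (file-2
rows over `(a′, b′, c′)`, typically of the index primes of `α`). Pure data.
[cite: Cohen1993, §6.2, §6.5] -/
structure ClFieldCertE where
  /-- the `α`-view record (v2.0, file 3) -/
  base : ClFieldCert
  /-- `η = (u₀ + u₁α + u₂α²)/d` -/
  u : ℤ × ℤ × ℤ
  /-- `η = (u₀ + u₁α + u₂α²)/d`, `0 < d` -/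
  d : ℕ
  /-- `h = X³ + a′X² + b′X + c′`, the minimal polynomial of `η` -/
  a' : ℤ
  /-- `h = X³ + a′X² + b′X + c′` -/
  b' : ℤ
  /-- `h = X³ + a′X² + b′X + c′` -/
  c' : ℤ
  /-- a modulus modulo which `h` has no root (irreducibility of `h`) -/
  pIrrE : ℕ
  /-- registry rows in the `η`-view (never `q`) -/
  primesE : List PrimeEntry
  /-- two-view class certificates for the sweep (may be empty) -/
  c2 : ClsCert2

namespace ClFieldCertE

variable (fe : ClFieldCertE)

/-- All primes whose primality the row files discharge: those of `base`, then the `η`-row primes. -/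
def primeListE : List ℕ := fe.base.primeList ++ fe.primesE.map PrimeEntry.p

/-- `η`-registry clause: every `η`-row is checked over `(a′, b′, c′)` and its prime is not `q`. Computable. -/
def checkRegistryE : Bool :=
  fe.primesE.all fun e => e.check fe.a' fe.b' fe.c' && e.p != fe.base.q

/-- The view-local part of a two-view class certificate: `m` prime to `p`, `Z ∈ (p, G)` by coefficients,
`|N(Z)| = m³ · p^deg · q^j`. Computable. -/
def classRel2 (A B C₀ : ℤ) (m q : ℕ) (C : PCode) (Z : ℤ × ℤ × ℤ) (j : ℕ) : Bool :=
  decide (Nat.Coprime m C.1) && memCode C Z &&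
    decide ((normFormZ A B C₀ Z.1 Z.2.1 Z.2.2).natAbs = m ^ 3 * (C.1 ^ codeDeg C * q ^ j))

/-- **Two-view class certificate** of the code `C` of a row in view `tag` (`true` = `α`): the certificate is
for this code and view, the Bezout pair and the two-view consistency hold, the view's multiplier is prime to `p`,
the view's coordinates lie in the code's prime, and `|N| = m³ · p^deg · q^j`. Computable.
[cite: Cohen1993, §6.5 (relations)] -/
def classCheck2 (tag : Bool) (C : PCode) (ce : (Bool × PCode) × (ℤ × ℤ × ℤ) × (ℤ × ℤ × ℤ) × ℕ) : Bool :=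
  (ce.1.1 == tag) && (ce.1.2 == C) && bezoutCheck fe.c2.s fe.c2.t fe.c2.m₁ fe.c2.m₂ &&
    twoViewCheck fe.base.a fe.base.b fe.base.c fe.u fe.d fe.c2.m₁ fe.c2.m₂ ce.2.1 ce.2.2.1 &&
    (bif tag then classRel2 fe.base.a fe.base.b fe.base.c fe.c2.m₁ fe.base.q C ce.2.1 ce.2.2.2
      else classRel2 fe.a' fe.b' fe.c' fe.c2.m₂ fe.base.q C ce.2.2.1 ce.2.2.2)

/-- **Two-view sweep**: the Minkowski inequality against `gcd(Δ(g), Δ(h))` (a multiple of `d_K`, sharper than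
`Δ(g) = ind(α)²·d_K`; tree lemma `eq_top_of_classIn_lt_gcd`), coverage of every prime `p < bM` by `q`, an `α`-row or an
`η`-row, and a class certificate (relative to `q`) of every code of every row in range, each in its own view —
either a one-view certificate in the view's order (`classCheck`) or a two-view one (`classCheck2`). Computable. [cite: Marcus2018, Ch. 5, Cor. 2 to Thm. 35] -/
def checkSweepE : Bool :=
  decide (64 * (Int.gcd (MonicCubic.disc fe.base.a fe.base.b fe.base.c) (MonicCubic.disc fe.a' fe.b' fe.c') : ℤ) <
      799 * (fe.base.bM : ℤ) ^ 2) &&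
    ((List.range fe.base.bM).all fun n =>
      decide (n < 2) || ClFieldCert.smallFactor n || n == fe.base.q || (fe.base.primes.any fun e => e.p == n) ||
        fe.primesE.any fun e => e.p == n) &&
    (fe.base.primes.all fun e => decide (fe.base.bM ≤ e.p) ||
      e.codes.all fun C => (e.cls.any fun dd =>
        classCheck fe.base.a fe.base.b fe.base.c fe.base.q fe.base.bM C dd) ||
        fe.c2.certs.any fun ce => fe.classCheck2 true C ce) &&
    fe.primesE.all fun e => decide (fe.base.bM ≤ e.p) ||
      e.codes.all fun C => (e.cls.any fun dd => classCheck fe.a' fe.b' fe.c' fe.base.q fe.base.bM C dd) ||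
        fe.c2.certs.any fun ce => fe.classCheck2 false C ce

/-- **The signature-free two-view core**: registry core of `base`, the `η` certificate, irreducibility of `h`,
the `η`-registry, the two-view sweep. Computable; run once per field by `decide +kernel`. -/
def checkCoreE : Bool :=
  fe.base.checkReg && etaCheck fe.base.a fe.base.b fe.base.c fe.u fe.d fe.a' fe.b' fe.c' &&
    noRootMod fe.pIrrE fe.a' fe.b' fe.c' && fe.checkRegistryE && fe.checkSweepE

/-! ## Soundness -/

/-- The registry core of `base` holds. -/
theorem checkReg_of_coreE (hE : fe.checkCoreE = true) : fe.base.checkReg = true := by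
  simp only [checkCoreE, Bool.and_eq_true] at hE
  exact hE.1.1.1.1

/-- The `η` certificate holds. -/
theorem etaCheck_of_coreE (hE : fe.checkCoreE = true) :
    etaCheck fe.base.a fe.base.b fe.base.c fe.u fe.d fe.a' fe.b' fe.c' = true := by
  simp only [checkCoreE, Bool.and_eq_true] at hE
  exact hE.1.1.1.2

/-- `0 < d`. -/
theorem d_pos (hE : fe.checkCoreE = true) : 0 < fe.d := pos_of_etaCheck (fe.etaCheck_of_coreE hE)

/-- **`h(η) = 0`.** [folklore] -/
theorem aeval_eta (hθ : aeval θ (MonicCubic.poly fe.base.a fe.base.b fe.base.c) = 0)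
    (hE : fe.checkCoreE = true) : aeval (eta θ fe.u fe.d) (MonicCubic.poly fe.a' fe.b' fe.c') = 0 :=
  aeval_eta_eq_zero hθ (fe.etaCheck_of_coreE hE)

/-- `h` is irreducible. [folklore] -/
theorem irreducibleE (hE : fe.checkCoreE = true) : Irreducible (MonicCubic.polyQ fe.a' fe.b' fe.c') := by
  simp only [checkCoreE, Bool.and_eq_true] at hE
  exact irreducible_of_noRootMod hE.1.1.2

/-- `base` primes are prime (from the primality list). -/
theorem base_primeList (hpr : fe.primeListE.Forall Nat.Prime) : fe.base.primeList.Forall Nat.Prime := by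
  rw [List.forall_iff_forall_mem] at hpr ⊢
  exact fun p hp => hpr p (by simp only [primeListE, List.mem_append]; exact Or.inl hp)

/-- `η`-row primes are prime. -/
theorem prime_of_memE (hpr : fe.primeListE.Forall Nat.Prime) {e : PrimeEntry} (he : e ∈ fe.primesE) :
    e.p.Prime := by
  rw [List.forall_iff_forall_mem] at hpr
  refine hpr _ ?_
  simp only [primeListE, List.mem_append, List.mem_map]
  exact Or.inr ⟨e, he, rfl⟩

/-- Every `η`-row is checked over `(a′, b′, c′)`, and its prime is not `q`. -/
theorem rowE_check_of_mem (hE : fe.checkCoreE = true) {e : PrimeEntry} (he : e ∈ fe.primesE) :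
    e.check fe.a' fe.b' fe.c' = true ∧ e.p ≠ fe.base.q := by
  simp only [checkCoreE, checkRegistryE, Bool.and_eq_true, List.all_eq_true] at hE
  have h := hE.1.2 e he
  exact ⟨h.1, by simpa using h.2⟩

/-- Soundness of a two-view class certificate in the `α`-view. [cite: Cohen1993, §6.5 (relations)] -/
theorem classIn_of_classCheck2_alpha (hθ : aeval θ (MonicCubic.poly fe.base.a fe.base.b fe.base.c) = 0)
    (h3 : finrank ℚ K = 3) (hE : fe.checkCoreE = true) {e : PrimeEntry} (hp : e.p.Prime)
    (hrow : e.check fe.base.a fe.base.b fe.base.c = true) {C : PCode} (hC : C ∈ e.codes) (hq : fe.base.q.Prime)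
    {ce : (Bool × PCode) × (ℤ × ℤ × ℤ) × (ℤ × ℤ × ℤ) × ℕ} (h : fe.classCheck2 true C ce = true) :
    ClassIn (Subgroup.closure {cc : ClassGroup (𝓞 K) | ∃ (J : Ideal (𝓞 K)) (hJ : J ∈ (Ideal (𝓞 K))⁰),
      ((fe.base.q : ℕ) : 𝓞 K) ∈ J ∧ ClassGroup.mk0 ⟨J, hJ⟩ = cc}) (idealOf hθ C) := by
  simp only [classCheck2, classRel2, cond_true, Bool.and_eq_true, beq_iff_eq, decide_eq_true_eq] at h
  obtain ⟨⟨⟨⟨-, rfl⟩, hb⟩, htv⟩, ⟨hcop, hmem⟩, hN⟩ := h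
  have hirr := fe.base.irreducible_of_reg (fe.checkReg_of_coreE hE)
  have hη := fe.aeval_eta hθ hE
  have hβ := natCast_mul_twoViewElt_alpha hθ (fe.d_pos hE) hη hb htv
  exact classIn_of_rel2 hirr hθ h3 hp hrow hC hq hcop hmem hβ hN

/-- Soundness of a two-view class certificate in the `η`-view. [cite: Cohen1993, §6.5 (relations)] -/
theorem classIn_of_classCheck2_eta (hθ : aeval θ (MonicCubic.poly fe.base.a fe.base.b fe.base.c) = 0)
    (h3 : finrank ℚ K = 3) (hE : fe.checkCoreE = true) {e : PrimeEntry} (hp : e.p.Prime)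
    (hrow : e.check fe.a' fe.b' fe.c' = true) {C : PCode} (hC : C ∈ e.codes) (hq : fe.base.q.Prime)
    {ce : (Bool × PCode) × (ℤ × ℤ × ℤ) × (ℤ × ℤ × ℤ) × ℕ} (h : fe.classCheck2 false C ce = true) :
    ClassIn (Subgroup.closure {cc : ClassGroup (𝓞 K) | ∃ (J : Ideal (𝓞 K)) (hJ : J ∈ (Ideal (𝓞 K))⁰),
      ((fe.base.q : ℕ) : 𝓞 K) ∈ J ∧ ClassGroup.mk0 ⟨J, hJ⟩ = cc}) (idealOf (fe.aeval_eta hθ hE) C) := by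
  simp only [classCheck2, classRel2, cond_false, Bool.and_eq_true, beq_iff_eq, decide_eq_true_eq] at h
  obtain ⟨⟨⟨⟨-, rfl⟩, hb⟩, htv⟩, ⟨hcop, hmem⟩, hN⟩ := h
  have hirr' := fe.irreducibleE hE
  have hη := fe.aeval_eta hθ hE
  have hβ := natCast_mul_twoViewElt_eta hθ (fe.d_pos hE) hη hb htv
  exact classIn_of_rel2 hirr' hη h3 hp hrow hC hq hcop hmem hβ hN

/-- **The classes of the primes above `q` generate the class group** (two-view sweep).
[cite: Marcus2018, Ch. 5, Cor. 2 to Thm. 35] [cite: Cohen1993, §6.5] -/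
theorem closure_q_eq_top_of_coreE (hθ : aeval θ (MonicCubic.poly fe.base.a fe.base.b fe.base.c) = 0)
    (h3 : finrank ℚ K = 3) (hE : fe.checkCoreE = true) (hpr : fe.primeListE.Forall Nat.Prime) :
    Subgroup.closure {cc : ClassGroup (𝓞 K) | ∃ (J : Ideal (𝓞 K)) (hJ : J ∈ (Ideal (𝓞 K))⁰),
      ((fe.base.q : ℕ) : 𝓞 K) ∈ J ∧ ClassGroup.mk0 ⟨J, hJ⟩ = cc} = ⊤ := by
  have hR := fe.checkReg_of_coreE hE
  have hprb := fe.base_primeList hpr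
  have hirr := fe.base.irreducible_of_reg hR
  have hirr' := fe.irreducibleE hE
  have hη := fe.aeval_eta hθ hE
  have hE' := hE
  simp only [checkCoreE, checkSweepE, Bool.and_eq_true, decide_eq_true_eq, List.all_eq_true, List.mem_range,
    Bool.or_eq_true, beq_iff_eq, List.any_eq_true] at hE'
  obtain ⟨-, ⟨⟨hd, hcov⟩, hcls⟩, hclsE⟩ := hE'
  refine eq_top_of_classIn_lt_gcd hirr hθ hirr' hη h3 (b := fe.base.bM) hd fun p hpb hp P hP hlt => ?_
  have hpP : (p : 𝓞 K) ∈ P := sweep_natCast_mem p hP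
  have hPr : P.IsPrime := hP.1
  rcases hcov p hpb with (((hlt2 | hsf) | rfl) | ⟨e, he, hep⟩) | ⟨e, he, hep⟩
  · exact absurd hp.two_le (by omega)
  · rw [ClFieldCert.smallFactor_eq_false hp] at hsf; exact absurd hsf Bool.false_ne_true
  · rcases fe.base.qcover_of_reg hθ h3 hR hprb P hPr hpP with h | h <;> rw [h]
    · exact classIn_tsupp_span_pair_self _ _
    · exact classIn_tsupp_span_pair_self _ _
  · subst hep
    have hrow := (fe.base.row_check_of_mem_reg hR he).1
    have hp' := fe.base.prime_of_mem hprb he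
    obtain ⟨C, hC, rfl⟩ := cover_of_check hirr hθ h3 hp' hrow P hPr hpP
    rcases hcls e he with hb | hall
    · exfalso
      refine not_pow_inertiaDeg_lt (mem_primesOver_of_check hirr hθ h3 hp' hrow hC)
        (absNorm_of_check hirr hθ h3 hp' hrow hC) ?_ hlt
      exact hb.trans (Nat.le_self_pow (ClFieldCert.codeDeg_pos C).ne' _)
    · rcases hall C hC with ⟨dd, -, hcc⟩ | ⟨ce, -, hce⟩
      · exact classIn_of_classCheck hirr hθ h3 hp' hrow hC (fe.base.q_prime hprb) hcc hlt
      · exact fe.classIn_of_classCheck2_alpha hθ h3 hE hp' hrow hC (fe.base.q_prime hprb) hce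
  · -- an `η`-row: the same argument in the `η`-view
    subst hep
    have hrow := (fe.rowE_check_of_mem hE he).1
    have hp' := fe.prime_of_memE hpr he
    obtain ⟨C, hC, rfl⟩ := cover_of_check hirr' hη h3 hp' hrow P hPr hpP
    rcases hclsE e he with hb | hall
    · exfalso
      refine not_pow_inertiaDeg_lt (mem_primesOver_of_check hirr' hη h3 hp' hrow hC)
        (absNorm_of_check hirr' hη h3 hp' hrow hC) ?_ hlt
      exact hb.trans (Nat.le_self_pow (ClFieldCert.codeDeg_pos C).ne' _)
    · rcases hall C hC with ⟨dd, -, hcc⟩ | ⟨ce, -, hce⟩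
      · exact classIn_of_classCheck hirr' hη h3 hp' hrow hC (fe.base.q_prime hprb) hcc hlt
      · exact fe.classIn_of_classCheck2_eta hθ h3 hE hp' hrow hC (fe.base.q_prime hprb) hce

end ClFieldCertE

end Summit.BirchSwinnertonDyer.BirchSwinnertonDyer.Rank2Observatory.TwoDescCl
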